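import Literature.Combinatorics.Additive.ProductSpaceGlobalHypercontractivity
import Literature.Computability.Complexity.HypercontractivityTwoQ
import HarnessLib

/-!
# Rademacher encodings of a product space (KLM §3.1, §4.1: the operators `G_S`, Lemma 4.3, "`G` preserves `2`-norms")

Source: N. Keller, N. Lifshitz, O. Marcus, *Sharp hypercontractivity for global functions*,
arXiv:2307.01356 = J. Eur. Math. Soc. 2026 [KellerLifshitzMarcus2023], §3.1 (encodings), Lemma 4.3
(commutation rules), proof of Thm 4.1 ("`G_{S^c}` preserves `2`-norms", "`T_ρ G_S = G_S T_ρ`"), pp. 22–23,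
32–33 of the arXiv version (read first-hand; cell pnp-psdrank, lit g23). This is the operator-algebra half
of the proof of KLM Thm 4.1 for the product space `[m]^N` (the analytic half — Lemma 3.2, Prop 3.1, Thm 4.1 —
is `ProductSpaceHypercontractivity.lean`).

DESIGN. KLM encode a coordinate `x_i ∈ Ω` (`|Ω| = k`) by `k - 1` independent GAUSSIANS through an orthonormal
basis of `L²(Ω)`. Their proof uses of the encoding variables only that they are symmetric with unit variance
and satisfy `(2,q)`-hypercontractivity (Lemma 3.2: "as `Z` is symmetric, all of its odd moments vanish";
Thm 4.1: Thm 4.2 with `p = 2`). We therefore encode by RADEMACHER variables, for which the tree has the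
`(2,q)`-hypercontractive inequality (`HypercontractivityTwoQ.lean`), and we use the POINT encoding
`G_i F = E_i F + m^{-1/2} ∑_{a ∈ [m]} (L_i F)(x_i ↦ a) · χ_{(i,a)}` (`m` signs per coordinate instead of an
orthonormal basis; it is an isometry on `V^{={i}}` because `∑_a (L_i F)(x_i ↦ a) = 0`). All functions live on
ONE mixed space, as curried maps `F : [m]^N → ({±1}^{[N]×[m]} → ℝ)`; the `Ω`-side operators of
`ProductSpaceOperators.lean` act on the first argument (`opX`), the cube-side ones on the second.

CONTENTS. (1) Generic KERNEL-PRODUCT operators `kone`, `kprod` on a finite product space (recursion,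
commutation with `E_B`, `L_S`, restrictions, `T_{ρ,C}` on disjoint coordinates, linearity) — they give both
the encodings `G_A` and (2) the BRIDGE `noiseOperatorOn σ = noiseOn σ univ` between the kernel form of the
cube noise operator (`HypercontractivityTwoQ.lean`) and the Efron–Stein form (`ProductSpaceOperators.lean`),
whence the `(2,q)`-bound for `noiseOn σ univ` on a cube (`lqPow_noiseOn_univ_le`). (3) The mixed space,
`opX`, `liftX`, the norms `meanM`/`lqM`/`l2M` and their Fubini rules. (4) The encodings `enc1`/`encA`, their
recursion and commutation rules (KLM Lemma 4.3(2)), the isometry `l2M (encA A F) = l2M F` ("`G` preserves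
`2`-norms") and the intertwining `encA A ∘ T^{Ω}_{σ,A} = T^{cube}_{σ, bits A} ∘ encA A` (KLM Lemma 4.3(1)).

All proved, `0` sorry, no new definitions of Prop type, no instances/notation. WHAT THIS IS NOT: no
inequality of KLM §3.2 is here; nothing about `S_n`; no P-vs-NP content.
-/

noncomputable section

namespace Literature.Combinatorics.Additive.ProductSpace

open Finset
open Literature.Probability.RandomGraphs.LowDegree (sgn sgn_mul_self)
open Literature.Computability.Complexity.LowDegree (noiseOperatorOn flipAll
  noiseOperatorOn_hypercontractive_two_q sum_pow_eq_zero_of_odd)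

variable {ι : Type*} [Fintype ι] [DecidableEq ι] {α : ι → Type*} [∀ i, Fintype (α i)]

/-! ## Kernel-product operators on a product space -/

section Kernel

/-- **One-coordinate kernel operator** `(K_i g)(x) = |Ω_i|⁻¹ ∑_{a ∈ Ω_i} k_i(a, x_i) g(x[i ↦ a])` (a Markov-type
operator in coordinate `i`; `k ≡ 1` is `E_i`, `k_i(a,b) = 1 + σ χ(a)χ(b)` on `{±1}` is the noise `T_{σ,i}`, and
the encodings `G_i` of KLM §3.1 are of this form with a kernel depending on the encoding variables).
[cite: KellerLifshitzMarcus2023, §3.2.3 ("the operator `T_ρ^{(i)} = I ⊗ ⋯ ⊗ T_ρ ⊗ ⋯ ⊗ I`")] -/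
def kone (i : ι) (k : (i : ι) → α i → α i → ℝ) (g : ((i : ι) → α i) → ℝ) (x : (i : ι) → α i) : ℝ :=
  (∑ a : α i, k i a (x i) * g (Function.update x i a)) / Fintype.card (α i)

/-- **Kernel-product operator on the coordinates `A`**: `(K_A g)(x) = |X|⁻¹ ∑_y (∏_{i∈A} k_i(y_i, x_i)) g(A.piecewise y x)`
(the tensor product `⊗_{i ∈ A} K_i ⊗ ⊗_{i ∉ A} id`). [cite: KellerLifshitzMarcus2023, §3.1 ("`G_S = ⊗_{i∈S} G ⊗ ⊗_{i ∈ S^c} id`")] -/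
def kprod (A : Finset ι) (k : (i : ι) → α i → α i → ℝ) (g : ((i : ι) → α i) → ℝ) (x : (i : ι) → α i) : ℝ :=
  (∑ y : (i : ι) → α i, (∏ i ∈ A, k i (y i) (x i)) * g (A.piecewise y x)) / cardX α

/-- `K_∅ = id`. [cite: KellerLifshitzMarcus2023, §3.1] -/
theorem kprod_empty [∀ i, Nonempty (α i)] (k : (i : ι) → α i → α i → ℝ) (g : ((i : ι) → α i) → ℝ) :
    kprod ∅ k g = g := by
  funext x
  unfold kprod
  simp only [Finset.prod_empty, one_mul, Finset.piecewise_empty, Finset.sum_const, Finset.card_univ,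
    nsmul_eq_mul]
  rw [← cardX, mul_div_cancel_left₀ _ cardX_pos.ne']

/-- The pairs `(a, y) ↦ (y_i, y[i ↦ a])` form an involution of `Ω_i × X`. [folklore] -/
private def updSwap (i : ι) : (α i) × ((i : ι) → α i) ≃ (α i) × ((i : ι) → α i) where
  toFun p := (p.2 i, Function.update p.2 i p.1)
  invFun p := (p.2 i, Function.update p.2 i p.1)
  left_inv p := by rcases p with ⟨a, y⟩; simp
  right_inv p := by rcases p with ⟨a, y⟩; simp

/-- **Resampling one coordinate**: `∑_a ∑_y Φ(y[i ↦ a]) = |Ω_i| ∑_u Φ(u)`. [folklore] -/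
private theorem sum_sum_update (i : ι) (Φ : ((i : ι) → α i) → ℝ) :
    ∑ a : α i, ∑ y : (i : ι) → α i, Φ (Function.update y i a) = Fintype.card (α i) * ∑ u, Φ u := by
  rw [← Fintype.sum_prod_type' (f := fun (a : α i) (y : (i : ι) → α i) => Φ (Function.update y i a))]
  rw [show (∑ p : (α i) × ((i : ι) → α i), Φ (Function.update p.2 i p.1)) =
      ∑ p : (α i) × ((i : ι) → α i), (fun p' : (α i) × ((i : ι) → α i) => Φ p'.2) (updSwap i p) from rfl,
    Equiv.sum_comp (updSwap i) (fun p' : (α i) × ((i : ι) → α i) => Φ p'.2), Fintype.sum_prod_type]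
  simp only [Finset.sum_const, Finset.card_univ, nsmul_eq_mul]

omit [Fintype ι] [∀ i, Fintype (α i)] in
/-- Piecewise on disjoint coordinate sets commute. [folklore] -/
private theorem piecewise_comm_of_disjoint {A B : Finset ι} (hAB : Disjoint A B) (x y v : (i : ι) → α i) :
    A.piecewise y (B.piecewise v x) = B.piecewise v (A.piecewise y x) := by
  funext j
  by_cases hA : j ∈ A
  · have hB : j ∉ B := Finset.disjoint_left.1 hAB hA
    simp [Finset.piecewise, hA, hB]
  · by_cases hB : j ∈ B <;> simp [Finset.piecewise, hA, hB]

/-- **Recursion** `K_{A ∪ {i}} = K_i ∘ K_A` (`i ∉ A`). [cite: KellerLifshitzMarcus2023, §3.1 (tensor structure of `G_S`)] -/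
theorem kprod_insert [∀ i, Nonempty (α i)] {i : ι} {A : Finset ι} (hi : i ∉ A)
    (k : (i : ι) → α i → α i → ℝ) (g : ((i : ι) → α i) → ℝ) :
    kprod (insert i A) k g = kone i k (kprod A k g) := by
  funext x
  have hc : (0 : ℝ) < Fintype.card (α i) := by exact_mod_cast Fintype.card_pos
  set Φ : ((i : ι) → α i) → ℝ := fun u =>
    (∏ j ∈ insert i A, k j (u j) (x j)) * g ((insert i A).piecewise u x) with hΦ
  have key : ∀ (a : α i) (y : (i : ι) → α i),
      k i a (x i) * ((∏ j ∈ A, k j (y j) (Function.update x i a j)) *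
        g (A.piecewise y (Function.update x i a))) = Φ (Function.update y i a) := by
    intro a y
    have h1 : ∏ j ∈ A, k j (y j) (Function.update x i a j) =
        ∏ j ∈ A, k j (Function.update y i a j) (x j) := by
      refine Finset.prod_congr rfl fun j hj => ?_
      have hji : j ≠ i := fun h => hi (h ▸ hj)
      rw [Function.update_of_ne hji, Function.update_of_ne hji]
    have h2 : A.piecewise y (Function.update x i a) = (insert i A).piecewise (Function.update y i a) x := by
      funext j
      by_cases hji : j = i
      · subst hji; simp [Finset.piecewise, hi]
      · by_cases hjA : j ∈ A <;> simp [Finset.piecewise, hjA, hji]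
    rw [hΦ]
    simp only
    rw [Finset.prod_insert hi, Function.update_self, h1, h2]
    ring
  have hR : ∀ a : α i, k i a (x i) * kprod A k g (Function.update x i a) =
      (∑ y, Φ (Function.update y i a)) / cardX α := by
    intro a
    unfold kprod
    rw [mul_div_assoc', Finset.mul_sum]
    exact congrArg (· / cardX α) (Finset.sum_congr rfl fun y _ => key a y)
  unfold kone
  simp_rw [hR]
  rw [← Finset.sum_div, sum_sum_update, mul_div_assoc, mul_div_cancel_left₀ _ hc.ne']
  rfl

/-- `K_{{i}} = K_i`. [cite: KellerLifshitzMarcus2023, §3.1] -/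
theorem kprod_singleton [∀ i, Nonempty (α i)] (i : ι) (k : (i : ι) → α i → α i → ℝ)
    (g : ((i : ι) → α i) → ℝ) : kprod {i} k g = kone i k g := by
  rw [← Finset.insert_empty, kprod_insert (Finset.notMem_empty i), kprod_empty]

/-- `E_B K_A = K_A E_B` for disjoint `A, B`. [cite: KellerLifshitzMarcus2023, Lemma 4.3 (2) ("as the composition of operators is performed coordinate-wise")] -/
theorem condAvg_kprod_comm {A B : Finset ι} (hAB : Disjoint A B) (k : (i : ι) → α i → α i → ℝ)
    (g : ((i : ι) → α i) → ℝ) : condAvg B (kprod A k g) = kprod A k (condAvg B g) := by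
  funext x
  unfold condAvg kprod
  rw [← Finset.sum_div, div_div]
  simp_rw [mul_div_assoc', Finset.mul_sum]
  rw [← Finset.sum_div, div_div, Finset.sum_comm]
  congr 1
  refine Finset.sum_congr rfl fun y _ => Finset.sum_congr rfl fun v _ => ?_
  have hw : ∏ i ∈ A, k i (y i) (B.piecewise v x i) = ∏ i ∈ A, k i (y i) (x i) :=
    Finset.prod_congr rfl fun i hi => by
      rw [Finset.piecewise_eq_of_notMem _ _ _ (Finset.disjoint_left.1 hAB hi)]
  rw [hw, piecewise_comm_of_disjoint hAB]

omit [Fintype ι] [∀ i, Fintype (α i)] in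
/-- [folklore] -/
private theorem piecewise_restr_comm {S A : Finset ι} (hSA : Disjoint S A) (x y y₀ : (i : ι) → α i) :
    A.piecewise y (S.piecewise y₀ x) = S.piecewise y₀ (A.piecewise y x) :=
  piecewise_comm_of_disjoint hSA.symm x y y₀

/-- Restriction on `S` commutes with `K_A`, `A ∩ S = ∅`. [cite: KellerLifshitzMarcus2023, Lemma 4.3 (2)] -/
theorem restr_kprod_comm {S A : Finset ι} (hSA : Disjoint S A) (y₀ : (i : ι) → α i)
    (k : (i : ι) → α i → α i → ℝ) (g : ((i : ι) → α i) → ℝ) :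
    restr S y₀ (kprod A k g) = kprod A k (restr S y₀ g) := by
  funext x
  unfold restr kprod
  congr 1
  refine Finset.sum_congr rfl fun y _ => ?_
  have hw : ∏ i ∈ A, k i (y i) (S.piecewise y₀ x i) = ∏ i ∈ A, k i (y i) (x i) :=
    Finset.prod_congr rfl fun i hi => by
      rw [Finset.piecewise_eq_of_notMem _ _ _ (Finset.disjoint_right.1 hSA hi)]
  rw [hw, piecewise_restr_comm hSA]

/-- Linearity of `K_A`: sums. [cite: KellerLifshitzMarcus2023, §3.1] -/
theorem kprod_add (A : Finset ι) (k : (i : ι) → α i → α i → ℝ) (f g : ((i : ι) → α i) → ℝ) :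
    kprod A k (fun x => f x + g x) = fun x => kprod A k f x + kprod A k g x := by
  funext x; unfold kprod
  rw [← add_div, ← Finset.sum_add_distrib]
  congr 1
  exact Finset.sum_congr rfl fun y _ => by ring

/-- Linearity of `K_A`: scalars. [cite: KellerLifshitzMarcus2023, §3.1] -/
theorem kprod_smul (A : Finset ι) (k : (i : ι) → α i → α i → ℝ) (c : ℝ) (f : ((i : ι) → α i) → ℝ) :
    kprod A k (fun x => c * f x) = fun x => c * kprod A k f x := by
  funext x; unfold kprod
  rw [mul_div_assoc', Finset.mul_sum]
  congr 1
  exact Finset.sum_congr rfl fun y _ => by ring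

/-- Linearity of `K_A`: finite sums. [cite: KellerLifshitzMarcus2023, §3.1] -/
theorem kprod_finset_sum {κ : Type*} (s : Finset κ) (A : Finset ι) (k : (i : ι) → α i → α i → ℝ)
    (F : κ → ((i : ι) → α i) → ℝ) :
    kprod A k (fun x => ∑ c ∈ s, F c x) = fun x => ∑ c ∈ s, kprod A k (F c) x := by
  classical
  induction s using Finset.induction_on with
  | empty =>
    funext x; simp [kprod]
  | insert c s hc ih =>
    funext x
    simp_rw [Finset.sum_insert hc]
    rw [show (fun x => F c x + ∑ d ∈ s, F d x) = fun x => F c x + (fun x => ∑ d ∈ s, F d x) x from rfl,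
      kprod_add, ih]

/-- `L_S K_A = K_A L_S` for `S ∩ A = ∅`. [cite: KellerLifshitzMarcus2023, Lemma 4.3 (2)] -/
theorem lap_kprod_comm [∀ i, Nonempty (α i)] {S A : Finset ι} (hSA : Disjoint S A)
    (k : (i : ι) → α i → α i → ℝ) (g : ((i : ι) → α i) → ℝ) :
    lap S (kprod A k g) = kprod A k (lap S g) := by
  have h : (lap S g) = fun x => ∑ R ∈ S.powerset, (fun R x => (-1 : ℝ) ^ R.card * condAvg R g x) R x := by
    funext x; rfl
  rw [h, kprod_finset_sum]
  funext x
  unfold lap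
  refine Finset.sum_congr rfl fun R hR => ?_
  rw [Finset.mem_powerset] at hR
  rw [kprod_smul, condAvg_kprod_comm (hSA.mono_left hR).symm]

/-- **`D_{S,y} K_A = K_A D_{S,y}`** for `S ∩ A = ∅` (KLM Lemma 4.3(2) for kernel products).
[cite: KellerLifshitzMarcus2023, Lemma 4.3 (2)] -/
theorem deriv_kprod_comm [∀ i, Nonempty (α i)] {S A : Finset ι} (hSA : Disjoint S A) (y₀ : (i : ι) → α i)
    (k : (i : ι) → α i → α i → ℝ) (g : ((i : ι) → α i) → ℝ) :
    deriv S y₀ (kprod A k g) = kprod A k (deriv S y₀ g) := by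
  unfold deriv
  rw [lap_kprod_comm hSA, restr_kprod_comm hSA]

/-- **`T_{ρ,C} K_A = K_A T_{ρ,C}`** for `C ∩ A = ∅` (KLM Lemma 4.3(1)-type commutation on disjoint coordinates).
[cite: KellerLifshitzMarcus2023, Lemma 4.3] -/
theorem noiseOn_kprod_comm [∀ i, Nonempty (α i)] (ρ : ℝ) {C A : Finset ι} (hCA : Disjoint C A)
    (k : (i : ι) → α i → α i → ℝ) (g : ((i : ι) → α i) → ℝ) :
    noiseOn ρ C (kprod A k g) = kprod A k (noiseOn ρ C g) := by
  induction C using Finset.induction_on generalizing g with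
  | empty => rw [noiseOn_empty, noiseOn_empty]
  | insert j C hj ih =>
    have hjA : Disjoint {j} A := by
      rw [Finset.disjoint_singleton_left]
      exact Finset.disjoint_left.1 hCA (Finset.mem_insert_self j C)
    have hCA' : Disjoint C A := hCA.mono_left (Finset.subset_insert j C)
    rw [noiseOn_insert ρ hj, noiseOn_insert ρ hj, condAvg_kprod_comm hjA.symm, lap_kprod_comm hjA]
    rw [show (fun x => kprod A k (condAvg {j} g) x + ρ * kprod A k (lap {j} g) x) =
        kprod A k (fun x => condAvg {j} g x + ρ * lap {j} g x) by
      rw [kprod_add, kprod_smul]]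
    exact ih hCA' _

/-- Kernel products on disjoint coordinate sets commute. [cite: KellerLifshitzMarcus2023, Lemma 4.3] -/
theorem kprod_kprod_comm {A B : Finset ι} (hAB : Disjoint A B) (k k' : (i : ι) → α i → α i → ℝ)
    (g : ((i : ι) → α i) → ℝ) : kprod A k (kprod B k' g) = kprod B k' (kprod A k g) := by
  funext x
  unfold kprod
  simp_rw [mul_div_assoc', Finset.mul_sum]
  rw [← Finset.sum_div, ← Finset.sum_div, div_div, div_div, Finset.sum_comm]
  congr 1
  refine Finset.sum_congr rfl fun v _ => Finset.sum_congr rfl fun y _ => ?_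
  have h1 : ∏ i ∈ B, k' i (v i) (A.piecewise y x i) = ∏ i ∈ B, k' i (v i) (x i) :=
    Finset.prod_congr rfl fun i hi => by
      rw [Finset.piecewise_eq_of_notMem _ _ _ (Finset.disjoint_right.1 hAB hi)]
  have h2 : ∏ i ∈ A, k i (y i) (B.piecewise v x i) = ∏ i ∈ A, k i (y i) (x i) :=
    Finset.prod_congr rfl fun i hi => by
      rw [Finset.piecewise_eq_of_notMem _ _ _ (Finset.disjoint_left.1 hAB hi)]
  rw [h1, h2, piecewise_comm_of_disjoint hAB]
  ring

/-- **Recursion, inner form**: `K_{A ∪ {i}} = K_A ∘ K_i` (`i ∉ A`). [cite: KellerLifshitzMarcus2023, §3.1] -/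
theorem kprod_insert' [∀ i, Nonempty (α i)] {i : ι} {A : Finset ι} (hi : i ∉ A)
    (k : (i : ι) → α i → α i → ℝ) (g : ((i : ι) → α i) → ℝ) :
    kprod (insert i A) k g = kprod A k (kone i k g) := by
  rw [kprod_insert hi, ← kprod_singleton, kprod_kprod_comm (Finset.disjoint_singleton_left.2 hi),
    kprod_singleton]

omit [Fintype ι] [∀ i, Fintype (α i)] in
/-- [folklore] -/
private theorem piecewise_congr_off {A B : Finset ι} {x x' : (i : ι) → α i} (h : ∀ i, i ∉ B → x i = x' i)
    (y : (i : ι) → α i) : ∀ i, i ∉ B → A.piecewise y x i = A.piecewise y x' i := by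
  intro i hi
  by_cases hA : i ∈ A <;> simp [Finset.piecewise, hA, h i hi]

/-- `K_A g` does not depend on the `A`-coordinates when the kernels ignore their second argument.
[cite: KellerLifshitzMarcus2023, §3.1 ("`G_S f` is a function on `Ω^{S^c} × (ℝ^{k-1})^S`")] -/
theorem dependsOff_kprod (A : Finset ι) {k : (i : ι) → α i → α i → ℝ}
    (hk : ∀ i ∈ A, ∀ a b b', k i a b = k i a b') (g : ((i : ι) → α i) → ℝ) :
    DependsOff A (kprod A k g) := by
  intro x x' hxx'
  unfold kprod
  congr 1
  refine Finset.sum_congr rfl fun y _ => ?_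
  have h1 : ∏ i ∈ A, k i (y i) (x i) = ∏ i ∈ A, k i (y i) (x' i) :=
    Finset.prod_congr rfl fun i hi => hk i hi _ _ _
  have h2 : A.piecewise y x = A.piecewise y x' := by
    funext i
    by_cases hA : i ∈ A
    · simp [Finset.piecewise, hA]
    · simp [Finset.piecewise, hA, hxx' i hA]
  rw [h1, h2]

/-- `K_A` preserves "does not depend on `B`" for `B ∩ A = ∅`. [cite: KellerLifshitzMarcus2023, §3.1] -/
theorem dependsOff_kprod_of {A B : Finset ι} (hBA : Disjoint B A) {g : ((i : ι) → α i) → ℝ}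
    (hg : DependsOff B g) (k : (i : ι) → α i → α i → ℝ) : DependsOff B (kprod A k g) := by
  intro x x' hxx'
  unfold kprod
  congr 1
  refine Finset.sum_congr rfl fun y _ => ?_
  have h1 : ∏ i ∈ A, k i (y i) (x i) = ∏ i ∈ A, k i (y i) (x' i) :=
    Finset.prod_congr rfl fun i hi => by rw [hxx' i (Finset.disjoint_right.1 hBA hi)]
  rw [h1, hg _ _ (piecewise_congr_off hxx' y)]

/-- `E_A` is the kernel product with constant kernel `1`. [cite: KellerLifshitzMarcus2023, §2.2] -/
theorem condAvg_eq_kprod_one (A : Finset ι) (g : ((i : ι) → α i) → ℝ) :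
    condAvg A g = kprod A (fun _ _ _ => (1 : ℝ)) g := by
  funext x; unfold condAvg kprod; simp

/-- **`E_i` as an average over the `i`-th coordinate**: `(E_i g)(x) = |Ω_i|⁻¹ ∑_a g(x[i ↦ a])`.
[cite: KellerLifshitzMarcus2023, §2.2 ("`E_S` is the expected value obtained when resampling the coordinates in `S`")] -/
theorem condAvg_singleton_eq [∀ i, Nonempty (α i)] (i : ι) (g : ((i : ι) → α i) → ℝ) (x : (i : ι) → α i) :
    condAvg {i} g x = (∑ a : α i, g (Function.update x i a)) / Fintype.card (α i) := by
  rw [condAvg_eq_kprod_one, kprod_singleton]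
  unfold kone
  simp

/-- **Pull-through for the noise operator**: a factor not depending on `C` comes out of `T_{ρ,C}`.
[cite: KellerLifshitzMarcus2023, §2.2] -/
theorem noiseOn_mul_of_dependsOff [∀ i, Nonempty (α i)] (ρ : ℝ) {C : Finset ι} {c : ((i : ι) → α i) → ℝ}
    (hc : DependsOff C c) (g : ((i : ι) → α i) → ℝ) :
    noiseOn ρ C (fun x => c x * g x) = fun x => c x * noiseOn ρ C g x := by
  induction C using Finset.induction_on generalizing g with
  | empty => rw [noiseOn_empty, noiseOn_empty]
  | insert j C hj ih =>
    have hcC : DependsOff C c := hc.mono (Finset.subset_insert j C)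
    have hcj : DependsOff {j} c := hc.mono (by simp)
    rw [noiseOn_insert ρ hj, noiseOn_insert ρ hj]
    have h1 : (fun x => condAvg {j} (fun x => c x * g x) x + ρ * lap {j} (fun x => c x * g x) x) =
        fun x => c x * (condAvg {j} g x + ρ * lap {j} g x) := by
      funext x
      rw [lap_singleton, lap_singleton, condAvg_mul_of_dependsOff hcj]
      ring
    rw [h1, ih hcC]

/-- Linearity of `T_{ρ,A}`: finite sums. [cite: KellerLifshitzMarcus2023, §2.2] -/
theorem noiseOn_finset_sum [∀ i, Nonempty (α i)] {κ : Type*} (s : Finset κ) (ρ : ℝ) (A : Finset ι)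
    (F : κ → ((i : ι) → α i) → ℝ) :
    noiseOn ρ A (fun x => ∑ c ∈ s, F c x) = fun x => ∑ c ∈ s, noiseOn ρ A (F c) x := by
  funext x
  unfold noiseOn
  simp_rw [esPart_finset_sum, Finset.mul_sum]
  rw [Finset.sum_comm]

/-- **Pythagoras in one coordinate**: `‖g‖₂² = ‖E_i g‖₂² + ‖L_i g‖₂²`.
[cite: KellerLifshitzMarcus2023, Lemma 2.1 (1) (orthogonality of the Efron–Stein decomposition)] -/
theorem l2sq_eq_condAvg_add_lap [∀ i, Nonempty (α i)] (i : ι) (g : ((i : ι) → α i) → ℝ) :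
    l2sq g = l2sq (condAvg {i} g) + l2sq (lap {i} g) := by
  have hsa : ∑ x, condAvg {i} g x * condAvg {i} g x = ∑ x, condAvg {i} g x * g x := by
    rw [sum_mul_condAvg, condAvg_idem]
  have key : ∑ x, (g x ^ 2 - (condAvg {i} g x ^ 2 + lap {i} g x ^ 2)) = 0 := by
    have h : ∀ x, g x ^ 2 - (condAvg {i} g x ^ 2 + lap {i} g x ^ 2) =
        2 * (condAvg {i} g x * g x) - 2 * (condAvg {i} g x * condAvg {i} g x) := by
      intro x; simp only [lap_singleton]; ring
    simp_rw [h, Finset.sum_sub_distrib, ← Finset.mul_sum, hsa, sub_self]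
  rw [Finset.sum_sub_distrib, sub_eq_zero] at key
  unfold l2sq mean
  rw [← add_div, ← Finset.sum_add_distrib, key]

end Kernel

/-! ## The discrete cube: signs, the kernel form of the noise operator, `(2,q)`-hypercontractivity -/

section Cube

variable {κ : Type*} [Fintype κ] [DecidableEq κ]

/-- `|{±1}^κ| = 2^{|κ|}`. [cite: ODonnell2014, §1.2] -/
theorem cardX_cube : cardX (fun _ : κ => Bool) = 2 ^ Fintype.card κ := by
  unfold cardX
  rw [Fintype.card_pi]
  simp

/-- `∑_z χ_p(z) = 0`. [cite: ODonnell2014, §1.4 (orthogonality of characters)] -/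
theorem sum_sgn_apply (p : κ) : ∑ z : κ → Bool, sgn (z p) = 0 := by
  have h := sum_pow_eq_zero_of_odd (fun z : κ → Bool => sgn (z p)) (fun e => by
    show sgn (!(e p)) = -sgn (e p)
    cases e p <;> simp [sgn]) odd_one
  simpa using h

/-- `E_C χ_p = 0` for `p ∈ C`. [cite: ODonnell2014, §1.4] -/
theorem condAvg_sgn_eq_zero {C : Finset κ} {p : κ} (hp : p ∈ C) :
    condAvg (α := fun _ : κ => Bool) C (fun z => sgn (z p)) = fun _ => 0 := by
  funext z
  unfold condAvg
  have h : ∀ z' : κ → Bool, sgn (C.piecewise z' z p) = sgn (z' p) := fun z' => by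
    rw [Finset.piecewise_eq_of_mem _ _ _ hp]
  simp_rw [h, sum_sgn_apply, zero_div]

omit [Fintype κ] [DecidableEq κ] in
/-- `χ_p` does not depend on the coordinates `B ∌ p`. [cite: ODonnell2014, §1.4] -/
theorem dependsOff_sgn {B : Finset κ} {p : κ} (hp : p ∉ B) :
    DependsOff (α := fun _ : κ => Bool) B (fun z => sgn (z p)) :=
  fun z z' h => by show sgn (z p) = sgn (z' p); rw [h p hp]

/-- **`T_{σ,C} χ_p = σ χ_p`** for `p ∈ C`. [cite: ODonnell2014, Prop. 2.47 ("`T_ρ χ_S = ρ^{|S|} χ_S`")] -/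
theorem noiseOn_sgn (σ : ℝ) {C : Finset κ} {p : κ} (hp : p ∈ C) :
    noiseOn (α := fun _ : κ => Bool) σ C (fun z => sgn (z p)) = fun z => σ * sgn (z p) := by
  rw [← Finset.insert_erase hp, noiseOn_insert σ (Finset.notMem_erase p C)]
  have h1 : (fun z : κ → Bool => condAvg (α := fun _ : κ => Bool) {p} (fun z => sgn (z p)) z +
      σ * lap (α := fun _ : κ => Bool) {p} (fun z => sgn (z p)) z) = fun z => σ * sgn (z p) := by
    funext z
    rw [lap_singleton, condAvg_sgn_eq_zero (Finset.mem_singleton_self p)]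
    ring
  rw [h1]
  exact noiseOn_of_dependsOff σ (fun z z' h => by
    show σ * sgn (z p) = σ * sgn (z' p)
    rw [h p (Finset.notMem_erase p C)])

/-- The **noise kernel** on one bit: `k(b,c) = 1 + σ χ(b) χ(c)`. [cite: ODonnell2014, Def. 2.46] -/
def noiseKer (σ : ℝ) : (p : κ) → Bool → Bool → ℝ := fun _ b c => 1 + σ * sgn b * sgn c

/-- One-bit noise in kernel form is `E_p + σ L_p`. [cite: ODonnell2014, Def. 2.46] -/
theorem kone_noiseKer (σ : ℝ) (p : κ) (g : (κ → Bool) → ℝ) :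
    kone p (noiseKer σ) g = noiseOn (α := fun _ : κ => Bool) σ {p} g := by
  funext z
  rw [noiseOn_singleton]
  simp only
  rw [lap_singleton]
  simp only
  rw [condAvg_singleton_eq]
  unfold kone noiseKer
  simp only [Fintype.card_bool, Nat.cast_ofNat, Fintype.sum_bool]
  have hz : g z = g (Function.update z p (z p)) := by rw [Function.update_eq_self]
  cases hzp : z p
  · rw [hzp] at hz
    rw [hz]
    simp [sgn]
    ring
  · rw [hzp] at hz
    rw [hz]
    simp [sgn]
    ring

/-- **Kernel form = Efron–Stein form** of `T_{σ,C}` on the cube. [cite: ODonnell2014, Def. 2.46 / Prop. 2.47] -/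
theorem kprod_noiseKer_eq_noiseOn (σ : ℝ) (C : Finset κ) (g : (κ → Bool) → ℝ) :
    kprod C (noiseKer σ) g = noiseOn (α := fun _ : κ => Bool) σ C g := by
  induction C using Finset.induction_on generalizing g with
  | empty => rw [kprod_empty, noiseOn_empty]
  | insert p C hp ih =>
    rw [kprod_insert hp, ih, kone_noiseKer,
      noiseOn_noiseOn_of_disjoint σ (Finset.disjoint_singleton_left.2 hp), Finset.insert_eq]

/-- **Bridge**: the tree's kernel-form noise operator on `{±1}^κ` (`HypercontractivityTwoQ.noiseOperatorOn`)
is `T_{σ, univ}` of `ProductSpaceOperators`. [cite: ODonnell2014, Def. 2.46 / Prop. 2.47] -/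
theorem noiseOperatorOn_eq_noiseOn (σ : ℝ) (g : (κ → Bool) → ℝ) :
    noiseOperatorOn σ g = noiseOn (α := fun _ : κ => Bool) σ univ g := by
  rw [← kprod_noiseKer_eq_noiseOn]
  funext z
  unfold noiseOperatorOn kprod noiseKer
  rw [cardX_cube]
  congr 1
  refine Finset.sum_congr rfl fun x _ => ?_
  rw [Finset.piecewise_univ]
  ring

/-- **`(2,q)`-hypercontractivity of `T_{σ,univ}` on a cube**, `σ² ≤ 1/(q-1)`, `q ≥ 2`:
`‖T_σ g‖_q^q ≤ ‖g‖_2^q`. [cite: ODonnell2014, Thm. 9.21 ((2,q)-hypercontractivity); KellerLifshitzMarcus2023, Thm. 4.2 (used with `p = 2`)] -/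
theorem lqPow_noiseOn_univ_le {q σ : ℝ} (hq : 2 ≤ q) (hσ0 : 0 ≤ σ) (hσ : σ ^ 2 ≤ 1 / (q - 1))
    (g : (κ → Bool) → ℝ) :
    lqPow (α := fun _ : κ => Bool) q (noiseOn (α := fun _ : κ => Bool) σ univ g) ≤
      l2sq (α := fun _ : κ => Bool) g ^ (q / 2) := by
  have h := noiseOperatorOn_hypercontractive_two_q hq hσ0 hσ g
  rw [noiseOperatorOn_eq_noiseOn] at h
  have hL : lqPow (α := fun _ : κ => Bool) q (noiseOn (α := fun _ : κ => Bool) σ univ g) =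
      (∑ y, |noiseOn (α := fun _ : κ => Bool) σ univ g y| ^ q) / 2 ^ Fintype.card κ := by
    unfold lqPow mean; rw [cardX_cube]
  have hR : l2sq (α := fun _ : κ => Bool) g = (∑ y, g y ^ 2) / 2 ^ Fintype.card κ := by
    unfold l2sq mean; rw [cardX_cube]
  rw [hL, hR]
  have hq0 : 0 < q := by linarith
  have hL0 : 0 ≤ (∑ y, |noiseOn (α := fun _ : κ => Bool) σ univ g y| ^ q) / 2 ^ Fintype.card κ := by
    positivity
  have hR0 : 0 ≤ (∑ y, g y ^ 2) / (2 : ℝ) ^ Fintype.card κ := by positivity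
  calc (∑ y, |noiseOn (α := fun _ : κ => Bool) σ univ g y| ^ q) / 2 ^ Fintype.card κ
      = (((∑ y, |noiseOn (α := fun _ : κ => Bool) σ univ g y| ^ q) / 2 ^ Fintype.card κ) ^ (1 / q)) ^ q := by
        rw [← Real.rpow_mul hL0, one_div_mul_cancel hq0.ne', Real.rpow_one]
    _ ≤ (((∑ y, g y ^ 2) / (2 : ℝ) ^ Fintype.card κ) ^ (1 / 2 : ℝ)) ^ q :=
        Real.rpow_le_rpow (by positivity) h hq0.le
    _ = ((∑ y, g y ^ 2) / (2 : ℝ) ^ Fintype.card κ) ^ (q / 2) := by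
        rw [← Real.rpow_mul hR0]; congr 1; ring

/-- `E[c · χ_p] = 0` when the coefficient `c` does not read the sign `p`.
[cite: KellerLifshitzMarcus2023, Lemma 3.2 (proof: odd moments of the encoding variables vanish)] -/
theorem mean_mul_sgn_eq_zero {c : (κ → Bool) → ℝ} {p : κ} (hc : DependsOff (α := fun _ : κ => Bool) {p} c) :
    mean (α := fun _ : κ => Bool) (fun z => c z * sgn (z p)) = 0 := by
  rw [← mean_condAvg {p}, condAvg_mul_of_dependsOff hc, condAvg_sgn_eq_zero (Finset.mem_singleton_self p)]
  unfold mean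
  simp

/-- **Second moment of an affine form in independent signs** with sign-free coefficients:
`E[(c₀ + ∑_t c_t χ_{e(t)})²] = E[c₀²] + ∑_t E[c_t²]` (`e` injective; `c₀, c_t` do not read the signs `e(·)`).
[cite: KellerLifshitzMarcus2023, Thm. 4.1 (proof: "`G_{S^c}` preserves `2`-norms")] -/
theorem mean_sq_affine_sgn {τ : Type*} [Fintype τ] [DecidableEq τ] {c₀ : (κ → Bool) → ℝ}
    {c : τ → (κ → Bool) → ℝ} {e : τ → κ} (he : Function.Injective e)
    (h₀ : ∀ t, DependsOff (α := fun _ : κ => Bool) {e t} c₀)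
    (hc : ∀ t t', DependsOff (α := fun _ : κ => Bool) {e t} (c t')) :
    mean (α := fun _ : κ => Bool) (fun z => (c₀ z + ∑ t, c t z * sgn (z (e t))) ^ 2) =
      mean (α := fun _ : κ => Bool) (fun z => c₀ z ^ 2) + ∑ t, mean (α := fun _ : κ => Bool) (fun z => c t z ^ 2) := by
  have hexp : (fun z : κ → Bool => (c₀ z + ∑ t, c t z * sgn (z (e t))) ^ 2) = fun z =>
      (c₀ z ^ 2 + ∑ t, (2 * c₀ z * c t z) * sgn (z (e t))) +
        ∑ t, ∑ t', (c t z * c t' z * sgn (z (e t'))) * sgn (z (e t)) := by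
    funext z
    rw [add_sq, sq (∑ t, c t z * sgn (z (e t))), Finset.sum_mul_sum, Finset.mul_sum]
    congr 1
    · congr 1
      exact Finset.sum_congr rfl fun t _ => by ring
    · exact Finset.sum_congr rfl fun t _ => Finset.sum_congr rfl fun t' _ => by ring
  rw [hexp, mean_add, mean_add, mean_finset_sum, mean_finset_sum]
  have h1 : ∑ t, mean (α := fun _ : κ => Bool) (fun z => 2 * c₀ z * c t z * sgn (z (e t))) = 0 := by
    refine Finset.sum_eq_zero fun t _ => mean_mul_sgn_eq_zero (fun z z' h => ?_)
    show 2 * c₀ z * c t z = 2 * c₀ z' * c t z'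
    rw [h₀ t z z' h, hc t t z z' h]
  have h2 : ∀ t, mean (α := fun _ : κ => Bool) (fun z => ∑ t', c t z * c t' z * sgn (z (e t')) * sgn (z (e t))) =
      mean (α := fun _ : κ => Bool) (fun z => c t z ^ 2) := by
    intro t
    rw [mean_finset_sum, Fintype.sum_eq_single t (fun t' htt' => ?_)]
    · congr 1; funext z
      have := sgn_mul_self (z (e t))
      rw [mul_assoc, this]; ring
    · refine mean_mul_sgn_eq_zero (fun z z' h => ?_)
      have hne : e t' ∉ ({e t} : Finset κ) := by
        rw [Finset.mem_singleton]; exact fun h' => htt' (he h')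
      show c t z * c t' z * sgn (z (e t')) = c t z' * c t' z' * sgn (z' (e t'))
      rw [hc t t z z' h, hc t t' z z' h, h (e t') hne]
  simp_rw [h1, h2, add_zero]

end Cube

/-! ## The mixed space `[m]^N × {±1}^{[N]×[m]}` (curried) -/

section Mixed

variable {N m : ℕ}

/-- The encoding variables: one sign `χ_{(i,a)}` for every coordinate `i ∈ [N]` and value `a ∈ [m]`.
[cite: KellerLifshitzMarcus2023, §3.1] -/
abbrev Cube (N m : ℕ) : Type := (Fin N × Fin m) → Bool

/-- Functions on the mixed space `[m]^N × {±1}^{[N]×[m]}`, curried (first the `Ω`-part, then the signs).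
[cite: KellerLifshitzMarcus2023, §3.1 ("`L²(Ω^{S^c} × (ℝ^{k-1})^S)`")] -/
abbrev MixFun (N m : ℕ) : Type := (Fin N → Fin m) → Cube N m → ℝ

/-- An `Ω`-side operator acting on the first argument (`A ⊗ id`). [cite: KellerLifshitzMarcus2023, §2.1 (tensorisation)] -/
def opX (A : ((Fin N → Fin m) → ℝ) → (Fin N → Fin m) → ℝ) (F : MixFun N m) : MixFun N m :=
  fun x z => A (fun x' => F x' z) x

/-- A function on `[m]^N` as a function on the mixed space (constant in the signs).
[cite: KellerLifshitzMarcus2023, §3.1] -/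
def liftX (f : (Fin N → Fin m) → ℝ) : MixFun N m := fun x _ => f x

/-- [cite: KellerLifshitzMarcus2023, §2.1] -/
theorem opX_liftX (A : ((Fin N → Fin m) → ℝ) → (Fin N → Fin m) → ℝ) (f : (Fin N → Fin m) → ℝ) :
    opX A (liftX f) = liftX (A f) := rfl

/-- [cite: KellerLifshitzMarcus2023, §2.1] -/
theorem opX_opX (A A' : ((Fin N → Fin m) → ℝ) → (Fin N → Fin m) → ℝ) (F : MixFun N m) :
    opX A (opX A' F) = opX (fun g => A (A' g)) F := rfl

/-- Transfer of an identity `A ∘ A' = A' ∘ A` of `Ω`-side operators. [cite: KellerLifshitzMarcus2023, §2.1] -/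
theorem opX_comm_of {A A' : ((Fin N → Fin m) → ℝ) → (Fin N → Fin m) → ℝ}
    (h : ∀ g, A (A' g) = A' (A g)) (F : MixFun N m) : opX A (opX A' F) = opX A' (opX A F) := by
  funext x z
  exact congrFun (h fun x' => F x' z) x

/-- Transfer of an identity `A = A'` of `Ω`-side operators. [cite: KellerLifshitzMarcus2023, §2.1] -/
theorem opX_congr_of {A A' : ((Fin N → Fin m) → ℝ) → (Fin N → Fin m) → ℝ}
    (h : ∀ g, A g = A' g) (F : MixFun N m) : opX A F = opX A' F := by
  funext x z
  exact congrFun (h fun x' => F x' z) x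

/-- **Expectation on the mixed space** (uniform in both arguments). [cite: KellerLifshitzMarcus2023, §3.1] -/
def meanM (F : MixFun N m) : ℝ :=
  mean (α := fun _ : Fin N => Fin m) fun x => mean (α := fun _ : Fin N × Fin m => Bool) (F x)

/-- `‖F‖_q^q` on the mixed space. [cite: KellerLifshitzMarcus2023, §3.1] -/
def lqM (q : ℝ) (F : MixFun N m) : ℝ := meanM fun x z => |F x z| ^ q

/-- `‖F‖_2^2` on the mixed space. [cite: KellerLifshitzMarcus2023, §3.1] -/
def l2M (F : MixFun N m) : ℝ := meanM fun x z => F x z ^ 2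

/-- [cite: KellerLifshitzMarcus2023, §3.1] -/
theorem meanM_add (F G : MixFun N m) : meanM (fun x z => F x z + G x z) = meanM F + meanM G := by
  unfold meanM
  rw [← mean_add]
  congr 1; funext x
  exact mean_add (F x) (G x)

/-- [cite: KellerLifshitzMarcus2023, §3.1] -/
theorem meanM_smul (c : ℝ) (F : MixFun N m) : meanM (fun x z => c * F x z) = c * meanM F := by
  unfold meanM
  rw [← mean_smul]
  congr 1; funext x
  exact mean_smul c (F x)

/-- [cite: KellerLifshitzMarcus2023, §3.1] -/
theorem meanM_sub (F G : MixFun N m) : meanM (fun x z => F x z - G x z) = meanM F - meanM G := by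
  unfold meanM
  rw [← mean_sub]
  congr 1; funext x
  exact mean_sub (F x) (G x)

/-- [cite: KellerLifshitzMarcus2023, §3.1] -/
theorem meanM_finset_sum {τ : Type*} (s : Finset τ) (F : τ → MixFun N m) :
    meanM (fun x z => ∑ t ∈ s, F t x z) = ∑ t ∈ s, meanM (F t) := by
  unfold meanM
  rw [← mean_finset_sum]
  congr 1; funext x
  exact mean_finset_sum s (fun t => F t x)

/-- [cite: KellerLifshitzMarcus2023, §3.1] -/
theorem meanM_mono [NeZero m] {F G : MixFun N m} (h : ∀ x z, F x z ≤ G x z) : meanM F ≤ meanM G :=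
  mean_mono fun x => mean_mono (h x)

/-- [cite: KellerLifshitzMarcus2023, §3.1] -/
theorem meanM_nonneg [NeZero m] {F : MixFun N m} (h : ∀ x z, 0 ≤ F x z) : 0 ≤ meanM F :=
  mean_nonneg fun x => mean_nonneg (h x)

/-- [cite: KellerLifshitzMarcus2023, §3.1] -/
theorem lqM_nonneg [NeZero m] (q : ℝ) (F : MixFun N m) : 0 ≤ lqM q F :=
  meanM_nonneg fun x z => by positivity

/-- [cite: KellerLifshitzMarcus2023, §3.1] -/
theorem l2M_nonneg [NeZero m] (F : MixFun N m) : 0 ≤ l2M F :=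
  meanM_nonneg fun x z => by positivity

/-- **Fubini**: the mixed expectation with the sign-average outside. [cite: KellerLifshitzMarcus2023, §3.2.3 ("the last equality follows from Fubini's theorem")] -/
theorem meanM_swap (F : MixFun N m) :
    meanM F = mean (α := fun _ : Fin N × Fin m => Bool) fun z =>
      mean (α := fun _ : Fin N => Fin m) fun x => F x z := by
  unfold meanM mean
  simp only [Finset.sum_div]
  rw [Finset.sum_comm]
  exact Finset.sum_congr rfl fun z _ => Finset.sum_congr rfl fun x _ => by rw [div_div, div_div, mul_comm]

/-- A sign-free function has the same expectation on the mixed space. [cite: KellerLifshitzMarcus2023, §3.1] -/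
theorem meanM_liftX [NeZero m] (f : (Fin N → Fin m) → ℝ) :
    meanM (liftX f) = mean (α := fun _ : Fin N => Fin m) f := by
  unfold meanM liftX
  congr 1; funext x
  exact mean_const (f x)

/-- [cite: KellerLifshitzMarcus2023, §3.1] -/
theorem lqM_liftX [NeZero m] (q : ℝ) (f : (Fin N → Fin m) → ℝ) :
    lqM q (liftX f) = lqPow (α := fun _ : Fin N => Fin m) q f := by
  unfold lqM lqPow
  exact meanM_liftX (fun x => |f x| ^ q)

/-- [cite: KellerLifshitzMarcus2023, §3.1] -/
theorem l2M_liftX [NeZero m] (f : (Fin N → Fin m) → ℝ) :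
    l2M (liftX f) = l2sq (α := fun _ : Fin N => Fin m) f := by
  unfold l2M l2sq
  exact meanM_liftX (fun x => f x ^ 2)

/-- `‖c F‖_q^q = |c|^q ‖F‖_q^q`. [cite: KellerLifshitzMarcus2023, §3.1] -/
theorem lqM_smul (q c : ℝ) (F : MixFun N m) : lqM q (fun x z => c * F x z) = |c| ^ q * lqM q F := by
  unfold lqM
  rw [← meanM_smul]
  congr 1; funext x z
  rw [abs_mul, Real.mul_rpow (abs_nonneg _) (abs_nonneg _)]

/-- `E` is invariant under `E_B ⊗ id`. [cite: KellerLifshitzMarcus2023, §2.2] -/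
theorem meanM_opX_condAvg [NeZero m] (B : Finset (Fin N)) (F : MixFun N m) :
    meanM (opX (condAvg B) F) = meanM F := by
  rw [meanM_swap, meanM_swap]
  congr 1; funext z
  exact mean_condAvg B (fun x => F x z)

/-- **Fubini for restrictions** on the mixed space: `E_y E[F_{S→y}] = E[F]`.
[cite: KellerLifshitzMarcus2023, §4.1 (proof of Thm 4.1: `‖·‖_q^q = E_{x∼Ω^S} ‖(·)_{S→x}‖_q^q`)] -/
theorem mean_meanM_restr [NeZero m] (S : Finset (Fin N)) (F : MixFun N m) :
    mean (α := fun _ : Fin N => Fin m) (fun y => meanM (opX (restr S y) F)) = meanM F := by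
  have h1 : (fun y : Fin N → Fin m => meanM (opX (restr S y) F)) =
      fun y => mean (α := fun _ : Fin N × Fin m => Bool) fun z =>
        mean (α := fun _ : Fin N => Fin m) (restr S y fun x' => F x' z) := by
    funext y; rw [meanM_swap]; rfl
  rw [h1]
  have h2 : mean (α := fun _ : Fin N => Fin m) (fun y => mean (α := fun _ : Fin N × Fin m => Bool) fun z =>
        mean (α := fun _ : Fin N => Fin m) (restr S y fun x' => F x' z)) =
      mean (α := fun _ : Fin N × Fin m => Bool) (fun z => mean (α := fun _ : Fin N => Fin m) fun y =>
        mean (α := fun _ : Fin N => Fin m) (restr S y fun x' => F x' z)) :=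
    meanM_swap (fun y z => mean (α := fun _ : Fin N => Fin m) (restr S y fun x' => F x' z))
  rw [h2, meanM_swap]
  congr 1; funext z
  exact mean_mean_restr S (fun x' => F x' z)

/-! ### Blocks of signs -/

/-- The signs `χ_{(i,a)}`, `a ∈ [m]`, encoding coordinate `i`. [cite: KellerLifshitzMarcus2023, §3.1] -/
def blk (i : Fin N) : Finset (Fin N × Fin m) := univ.filter fun p => p.1 = i

/-- The signs encoding the coordinates in `A`. [cite: KellerLifshitzMarcus2023, §3.1] -/
def bits (A : Finset (Fin N)) : Finset (Fin N × Fin m) := univ.filter fun p => p.1 ∈ A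

/-- [cite: KellerLifshitzMarcus2023, §3.1] -/
@[simp] theorem mem_blk {i : Fin N} {p : Fin N × Fin m} : p ∈ blk (m := m) i ↔ p.1 = i := by simp [blk]

/-- [cite: KellerLifshitzMarcus2023, §3.1] -/
@[simp] theorem mem_bits {A : Finset (Fin N)} {p : Fin N × Fin m} : p ∈ bits (m := m) A ↔ p.1 ∈ A := by
  simp [bits]

/-- [cite: KellerLifshitzMarcus2023, §3.1] -/
theorem bits_insert (i : Fin N) (A : Finset (Fin N)) : bits (m := m) (insert i A) = blk i ∪ bits A := by
  ext p; simp

/-- [cite: KellerLifshitzMarcus2023, §3.1] -/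
theorem disjoint_blk_bits {i : Fin N} {A : Finset (Fin N)} (hi : i ∉ A) : Disjoint (blk (m := m) i) (bits A) := by
  rw [Finset.disjoint_left]
  intro p hp hp'
  rw [mem_blk] at hp; rw [mem_bits] at hp'
  exact hi (hp ▸ hp')

/-- [cite: KellerLifshitzMarcus2023, §3.1] -/
theorem bits_empty : bits (m := m) (∅ : Finset (Fin N)) = ∅ := by ext p; simp

/-- [cite: KellerLifshitzMarcus2023, §3.1] -/
theorem bits_univ : bits (m := m) (univ : Finset (Fin N)) = univ := by ext p; simp

/-! ### The encodings -/

/-- `s̄_i(z) = m⁻¹ ∑_a χ_{(i,a)}(z)`. [cite: KellerLifshitzMarcus2023, §3.1] -/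
def sbar (i : Fin N) (z : Cube N m) : ℝ := (∑ a : Fin m, sgn (z (i, a))) / m

/-- The **encoding kernel** `w_i(a; z) = 1 + √m (χ_{(i,a)}(z) - s̄_i(z))` (so that `m⁻¹ ∑_a w_i(a;z) g(x[i↦a]) =
E_i g + m^{-1/2} ∑_a (L_i g)(x[i↦a]) χ_{(i,a)}(z)`, the point form of KLM's `G_i`). [cite: KellerLifshitzMarcus2023, §3.1] -/
def encW (z : Cube N m) : (i : Fin N) → Fin m → Fin m → ℝ :=
  fun i a _ => 1 + Real.sqrt m * (sgn (z (i, a)) - sbar i z)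

/-- **`G_i`** (Rademacher point encoding of coordinate `i`). [cite: KellerLifshitzMarcus2023, §3.1 (the operator `G_i`)] -/
def enc1 (i : Fin N) (F : MixFun N m) : MixFun N m := fun x z => kone i (encW z) (fun x' => F x' z) x

/-- **`G_A = ⊗_{i∈A} G_i`**. [cite: KellerLifshitzMarcus2023, §3.1 (the operator `G_S`)] -/
def encA (A : Finset (Fin N)) (F : MixFun N m) : MixFun N m := fun x z => kprod A (encW z) (fun x' => F x' z) x

/-- The linear (sign) part of `G_i`: `m^{-1/2} ∑_a (L_i F)(x[i↦a], z) χ_{(i,a)}(z)`. [cite: KellerLifshitzMarcus2023, §3.1] -/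
def encLin (i : Fin N) (F : MixFun N m) : MixFun N m := fun x z =>
  (Real.sqrt m)⁻¹ * ∑ a : Fin m, lap {i} (fun x' => F x' z) (Function.update x i a) * sgn (z (i, a))

/-- `G_{{i}} = G_i`. [cite: KellerLifshitzMarcus2023, §3.1] -/
theorem encA_singleton [NeZero m] (i : Fin N) (F : MixFun N m) : encA {i} F = enc1 i F := by
  funext x z
  exact congrFun (kprod_singleton i (encW z) (fun x' => F x' z)) x

/-- `G_∅ = id`. [cite: KellerLifshitzMarcus2023, §3.1] -/
theorem encA_empty [NeZero m] (F : MixFun N m) : encA ∅ F = F := by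
  funext x z
  exact congrFun (kprod_empty (encW z) (fun x' => F x' z)) x

/-- `G_{A ∪ {i}} = G_i G_A` (`i ∉ A`). [cite: KellerLifshitzMarcus2023, §3.1] -/
theorem encA_insert [NeZero m] {i : Fin N} {A : Finset (Fin N)} (hi : i ∉ A) (F : MixFun N m) :
    encA (insert i A) F = enc1 i (encA A F) := by
  funext x z
  exact congrFun (kprod_insert hi (encW z) (fun x' => F x' z)) x

/-- `G_{A ∪ {i}} = G_A G_i` (`i ∉ A`). [cite: KellerLifshitzMarcus2023, §3.1] -/
theorem encA_insert' [NeZero m] {i : Fin N} {A : Finset (Fin N)} (hi : i ∉ A) (F : MixFun N m) :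
    encA (insert i A) F = encA A (enc1 i F) := by
  funext x z
  exact congrFun (kprod_insert' hi (encW z) (fun x' => F x' z)) x

/-- **The point form of `G_i`**: `G_i F = E_i F + m^{-1/2} ∑_a (L_i F)(x[i↦a]) χ_{(i,a)}`.
[cite: KellerLifshitzMarcus2023, §3.1 ("`G(α_0 + ∑ α_i f_i) = α_0 + ∑ α_i z_i`")] -/
theorem enc1_eq [NeZero m] (i : Fin N) (F : MixFun N m) :
    enc1 i F = fun x z => opX (condAvg {i}) F x z + encLin i F x z := by
  funext x z
  have hm : (0 : ℝ) < m := by exact_mod_cast Nat.pos_of_ne_zero (NeZero.ne m)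
  have hinv : (Real.sqrt m)⁻¹ = Real.sqrt m / m := by
    rw [eq_div_iff hm.ne', ← Real.sqrt_mul_self hm.le]
    rw [Real.sqrt_mul_self hm.le]
    rw [inv_mul_eq_div, Real.div_sqrt]
  set g : (Fin N → Fin m) → ℝ := fun x' => F x' z with hg
  have hE : ∀ a, condAvg {i} g (Function.update x i a) = condAvg {i} g x := fun a =>
    dependsOff_condAvg {i} g _ _ (fun j hj => by
      rw [Function.update_of_ne (by simpa using hj)])
  show kone i (encW z) g x = condAvg {i} g x + encLin i F x z
  unfold encLin kone encW sbar
  rw [← hg]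
  simp only [lap_singleton, hE, Fintype.card_fin]
  rw [condAvg_singleton_eq, Fintype.card_fin]
  set S : ℝ := ∑ a : Fin m, sgn (z (i, a)) with hS
  set G : ℝ := ∑ a : Fin m, g (Function.update x i a) with hG
  set P : ℝ := ∑ a : Fin m, sgn (z (i, a)) * g (Function.update x i a) with hP
  have hL : ∑ a : Fin m, (1 + Real.sqrt m * (sgn (z (i, a)) - S / m)) * g (Function.update x i a) =
      G + Real.sqrt m * P - Real.sqrt m * (S / m) * G := by
    have h : ∀ a : Fin m, (1 + Real.sqrt m * (sgn (z (i, a)) - S / m)) * g (Function.update x i a) =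
        g (Function.update x i a) + Real.sqrt m * (sgn (z (i, a)) * g (Function.update x i a)) -
          Real.sqrt m * (S / m) * g (Function.update x i a) := fun a => by ring
    simp_rw [h, Finset.sum_sub_distrib, Finset.sum_add_distrib, ← Finset.mul_sum]
    rfl
  have hR : ∑ a : Fin m, (g (Function.update x i a) - G / m) * sgn (z (i, a)) = P - G / m * S := by
    have h : ∀ a : Fin m, (g (Function.update x i a) - G / m) * sgn (z (i, a)) =
        sgn (z (i, a)) * g (Function.update x i a) - G / m * sgn (z (i, a)) := fun a => by ring
    simp_rw [h, Finset.sum_sub_distrib, ← Finset.mul_sum]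
    rfl
  rw [hL, hR, hinv]
  field_simp
  ring

/-- `G_i` commutes with `E_B`, `i ∉ B`. [cite: KellerLifshitzMarcus2023, Lemma 4.3 (2)] -/
theorem encA_condAvg_comm {A B : Finset (Fin N)} (hAB : Disjoint A B) (F : MixFun N m) :
    encA A (opX (condAvg B) F) = opX (condAvg B) (encA A F) := by
  funext x z
  exact congrFun (condAvg_kprod_comm hAB (encW z) (fun x' => F x' z)).symm x

/-- `G_A` commutes with `L_S`, `S ∩ A = ∅`. [cite: KellerLifshitzMarcus2023, Lemma 4.3 (2)] -/
theorem encA_lap_comm [NeZero m] {S A : Finset (Fin N)} (hSA : Disjoint S A) (F : MixFun N m) :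
    encA A (opX (lap S) F) = opX (lap S) (encA A F) := by
  funext x z
  exact congrFun (lap_kprod_comm hSA (encW z) (fun x' => F x' z)).symm x

/-- `G_A` commutes with restriction on `S`, `S ∩ A = ∅`. [cite: KellerLifshitzMarcus2023, Lemma 4.3 (2)] -/
theorem encA_restr_comm {S A : Finset (Fin N)} (hSA : Disjoint S A) (y : Fin N → Fin m) (F : MixFun N m) :
    encA A (opX (restr S y) F) = opX (restr S y) (encA A F) := by
  funext x z
  exact congrFun (restr_kprod_comm hSA y (encW z) (fun x' => F x' z)).symm x

/-- **`G_A D_{S,y} = D_{S,y} G_A`**, `S ∩ A = ∅` (KLM Lemma 4.3(2)). [cite: KellerLifshitzMarcus2023, Lemma 4.3 (2)] -/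
theorem encA_deriv_comm [NeZero m] {S A : Finset (Fin N)} (hSA : Disjoint S A) (y : Fin N → Fin m)
    (F : MixFun N m) : encA A (opX (deriv S y) F) = opX (deriv S y) (encA A F) := by
  funext x z
  exact congrFun (deriv_kprod_comm hSA y (encW z) (fun x' => F x' z)).symm x

/-- `G_A` commutes with `T_{ρ,C}` on the `Ω`-side, `C ∩ A = ∅`. [cite: KellerLifshitzMarcus2023, Lemma 4.3] -/
theorem encA_noiseOn_comm [NeZero m] (ρ : ℝ) {C A : Finset (Fin N)} (hCA : Disjoint C A) (F : MixFun N m) :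
    encA A (opX (noiseOn ρ C) F) = opX (noiseOn ρ C) (encA A F) := by
  funext x z
  exact congrFun (noiseOn_kprod_comm ρ hCA (encW z) (fun x' => F x' z)).symm x

/-- Linearity of `G_A`: sums. [cite: KellerLifshitzMarcus2023, §3.1] -/
theorem encA_add (A : Finset (Fin N)) (F G : MixFun N m) :
    encA A (fun x z => F x z + G x z) = fun x z => encA A F x z + encA A G x z := by
  funext x z
  exact congrFun (kprod_add A (encW z) (fun x' => F x' z) (fun x' => G x' z)) x

/-- Linearity of `G_A`: scalars. [cite: KellerLifshitzMarcus2023, §3.1] -/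
theorem encA_smul (A : Finset (Fin N)) (c : ℝ) (F : MixFun N m) :
    encA A (fun x z => c * F x z) = fun x z => c * encA A F x z := by
  funext x z
  exact congrFun (kprod_smul A (encW z) c (fun x' => F x' z)) x

/-! ### Dependence bookkeeping -/

/-- The kernel of block `i` only reads the signs of block `i`. [cite: KellerLifshitzMarcus2023, §3.1] -/
theorem encW_congr {z z' : Cube N m} {i : Fin N} (h : ∀ a, z (i, a) = z' (i, a)) : encW z i = encW z' i := by
  funext a b
  unfold encW sbar
  simp_rw [h]

/-- `G_A F` reads only the signs that `F` reads and those of the blocks `A`.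
[cite: KellerLifshitzMarcus2023, §3.1 ("`G_S : L²(Ω^n) → L²(Ω^{S^c} × (ℝ^{k-1})^S)`")] -/
theorem dependsOff_encA_cube {D : Finset (Fin N × Fin m)} {A : Finset (Fin N)} (hD : ∀ p ∈ D, p.1 ∉ A)
    {F : MixFun N m} (hF : ∀ x, DependsOff (α := fun _ : Fin N × Fin m => Bool) D (F x)) (x : Fin N → Fin m) :
    DependsOff (α := fun _ : Fin N × Fin m => Bool) D (encA A F x) := by
  intro z z' hzz'
  unfold encA kprod
  congr 1
  refine Finset.sum_congr rfl fun y _ => ?_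
  have h1 : ∏ j ∈ A, encW z j (y j) (x j) = ∏ j ∈ A, encW z' j (y j) (x j) :=
    Finset.prod_congr rfl fun j hj => by
      rw [encW_congr (fun a => hzz' (j, a) (fun hmem => hD _ hmem hj))]
  rw [h1]
  exact congrArg _ (hF _ z z' hzz')

/-- `Ω`-side operators do not introduce signs. [cite: KellerLifshitzMarcus2023, §3.1] -/
theorem dependsOff_opX_cube {D : Finset (Fin N × Fin m)} {F : MixFun N m}
    (hF : ∀ x, DependsOff (α := fun _ : Fin N × Fin m => Bool) D (F x))
    (A : ((Fin N → Fin m) → ℝ) → (Fin N → Fin m) → ℝ) (x : Fin N → Fin m) :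
    DependsOff (α := fun _ : Fin N × Fin m => Bool) D (opX A F x) := by
  intro z z' h
  show A (fun x' => F x' z) x = A (fun x' => F x' z') x
  rw [show (fun x' => F x' z) = fun x' => F x' z' from funext fun x' => hF x' z z' h]

/-- Sign-free functions read no signs. [cite: KellerLifshitzMarcus2023, §3.1] -/
theorem dependsOff_liftX (D : Finset (Fin N × Fin m)) (f : (Fin N → Fin m) → ℝ) (x : Fin N → Fin m) :
    DependsOff (α := fun _ : Fin N × Fin m => Bool) D (liftX f x) := fun _ _ _ => rfl

/-- `G_A F` does not depend on `x_A`. [cite: KellerLifshitzMarcus2023, §3.1] -/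
theorem dependsOff_encA_X (A : Finset (Fin N)) (F : MixFun N m) (z : Cube N m) :
    DependsOff (α := fun _ : Fin N => Fin m) A (fun x => encA A F x z) :=
  dependsOff_kprod A (fun _ _ _ _ _ => rfl) _

/-- `G_A` preserves "does not depend on `x_B`", `B ∩ A = ∅`. [cite: KellerLifshitzMarcus2023, §3.1] -/
theorem dependsOff_encA_X_of {A B : Finset (Fin N)} (hBA : Disjoint B A) {F : MixFun N m}
    (hF : ∀ z, DependsOff (α := fun _ : Fin N => Fin m) B (fun x => F x z)) (z : Cube N m) :
    DependsOff (α := fun _ : Fin N => Fin m) B (fun x => encA A F x z) :=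
  dependsOff_kprod_of hBA (hF z) _

/-! ### `G` preserves `2`-norms -/

/-- `E` is invariant under `id ⊗ E_C` (sign side). [cite: KellerLifshitzMarcus2023, §2.2] -/
theorem meanM_opB_condAvg [NeZero m] (C : Finset (Fin N × Fin m)) (F : MixFun N m) :
    meanM (fun x => condAvg (α := fun _ : Fin N × Fin m => Bool) C (F x)) = meanM F := by
  unfold meanM
  congr 1; funext x
  exact mean_condAvg C (F x)

/-- `∑_a E_x φ(x[i↦a]) = m · E φ`. [cite: KellerLifshitzMarcus2023, §2.2] -/
theorem sum_mean_update [NeZero m] (i : Fin N) (φ : (Fin N → Fin m) → ℝ) :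
    ∑ a : Fin m, mean (α := fun _ : Fin N => Fin m) (fun x => φ (Function.update x i a)) =
      m * mean (α := fun _ : Fin N => Fin m) φ := by
  have h : (fun x : Fin N → Fin m => ∑ a : Fin m, φ (Function.update x i a)) =
      fun x => (m : ℝ) * condAvg {i} φ x := by
    funext x
    rw [condAvg_singleton_eq, Fintype.card_fin, mul_div_cancel₀ _ (by exact_mod_cast NeZero.ne m)]
  rw [← mean_finset_sum, h, mean_smul, mean_condAvg]

/-- **`‖G_i F‖₂ = ‖F‖₂`** for `F` not reading the signs of block `i`: `G_i` is an isometry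
(`E_i F ⊥` the sign part, and `‖m^{-1/2}∑_a (L_iF)(x[i↦a]) χ_{(i,a)}‖₂² = E_i (L_i F)² `).
[cite: KellerLifshitzMarcus2023, Thm. 4.1 (proof: "the last equality holds since `G_{S^c}` preserves `2`-norms")] -/
theorem l2M_enc1 [NeZero m] (i : Fin N) {F : MixFun N m}
    (hF : ∀ x, DependsOff (α := fun _ : Fin N × Fin m => Bool) (blk i) (F x)) :
    l2M (enc1 i F) = l2M F := by
  have hm : (0 : ℝ) < m := by exact_mod_cast Nat.pos_of_ne_zero (NeZero.ne m)
  rw [enc1_eq]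
  -- the coefficients
  set c : Fin m → MixFun N m := fun a x z =>
    (Real.sqrt m)⁻¹ * lap {i} (fun x' => F x' z) (Function.update x i a) with hc
  have hΛ : ∀ x z, encLin i F x z = ∑ a, c a x z * sgn (z (i, a)) := by
    intro x z
    unfold encLin
    rw [Finset.mul_sum]
    exact Finset.sum_congr rfl fun a _ => by rw [hc]; ring
  have hE : ∀ x, DependsOff (α := fun _ : Fin N × Fin m => Bool) (blk i) (opX (condAvg {i}) F x) :=
    dependsOff_opX_cube hF _
  have hcd : ∀ a x, DependsOff (α := fun _ : Fin N × Fin m => Bool) (blk i) (c a x) := by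
    intro a x z z' h
    have := dependsOff_opX_cube hF (lap {i}) (Function.update x i a) z z' h
    show (Real.sqrt m)⁻¹ * _ = (Real.sqrt m)⁻¹ * _
    exact congrArg _ this
  have hsub : ∀ a : Fin m, ({(i, a)} : Finset (Fin N × Fin m)) ⊆ blk i := by
    intro a p hp; rw [Finset.mem_singleton] at hp; subst hp; simp
  -- sign side, pointwise in `x`
  have step1 : ∀ x, mean (α := fun _ : Fin N × Fin m => Bool)
      (fun z => (opX (condAvg {i}) F x z + encLin i F x z) ^ 2) =
      mean (α := fun _ : Fin N × Fin m => Bool) (fun z => opX (condAvg {i}) F x z ^ 2) +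
        ∑ a, mean (α := fun _ : Fin N × Fin m => Bool) (fun z => c a x z ^ 2) := by
    intro x
    simp_rw [hΛ]
    exact mean_sq_affine_sgn (e := fun a : Fin m => (i, a)) (fun a b h => by simpa using h)
      (fun a => (hE x).mono (hsub a)) (fun a a' => (hcd a' x).mono (hsub a))
  have hl : l2M (fun x z => opX (condAvg {i}) F x z + encLin i F x z) =
      l2M (opX (condAvg {i}) F) + ∑ a, meanM (fun x z => c a x z ^ 2) := by
    unfold l2M meanM
    simp_rw [step1]
    rw [mean_add, mean_finset_sum]
  -- `∑_a E (c_a)² = ‖L_i F‖₂²`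
  have hc2 : ∑ a, meanM (fun x z => c a x z ^ 2) = l2M (opX (lap {i}) F) := by
    have h1 : ∀ a, meanM (fun x z => c a x z ^ 2) = mean (α := fun _ : Fin N => Fin m) (fun x =>
        (fun x' => (m : ℝ)⁻¹ * mean (α := fun _ : Fin N × Fin m => Bool) (fun z => opX (lap {i}) F x' z ^ 2))
          (Function.update x i a)) := by
      intro a
      unfold meanM
      congr 1; funext x
      simp only [hc]
      rw [← mean_smul]
      congr 1; funext z
      rw [mul_pow, inv_pow, Real.sq_sqrt hm.le]
      rfl
    rw [Finset.sum_congr rfl (fun a _ => h1 a)]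
    refine (sum_mean_update i (fun x' => (m : ℝ)⁻¹ *
      mean (α := fun _ : Fin N × Fin m => Bool) (fun z => opX (lap {i}) F x' z ^ 2))).trans ?_
    rw [mean_smul, ← mul_assoc, mul_inv_cancel₀ hm.ne', one_mul]
    rfl
  -- `‖E_i F‖² + ‖L_i F‖² = ‖F‖²`, sign-average outside
  have hpy : l2M (opX (condAvg {i}) F) + l2M (opX (lap {i}) F) = l2M F := by
    unfold l2M
    rw [meanM_swap, meanM_swap, meanM_swap, ← mean_add]
    congr 1; funext z
    exact (l2sq_eq_condAvg_add_lap i (fun x' => F x' z)).symm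
  rw [hl, hc2, hpy]

/-- **`G_A` preserves `2`-norms** on functions not reading the signs of the blocks `A`.
[cite: KellerLifshitzMarcus2023, Thm. 4.1 (proof: "`G_{S^c}` preserves `2`-norms")] -/
theorem l2M_encA [NeZero m] {A : Finset (Fin N)} {F : MixFun N m}
    (hF : ∀ x, DependsOff (α := fun _ : Fin N × Fin m => Bool) (bits A) (F x)) :
    l2M (encA A F) = l2M F := by
  induction A using Finset.induction_on generalizing F with
  | empty => rw [encA_empty]
  | insert i A hi ih =>
    have hFi : ∀ x, DependsOff (α := fun _ : Fin N × Fin m => Bool) (blk i) (F x) := fun x =>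
      (hF x).mono (by rw [bits_insert]; exact Finset.subset_union_left)
    have hFA : ∀ x, DependsOff (α := fun _ : Fin N × Fin m => Bool) (bits A) (F x) := fun x =>
      (hF x).mono (by rw [bits_insert]; exact Finset.subset_union_right)
    rw [encA_insert hi, l2M_enc1 i (dependsOff_encA_cube (fun p hp => by
      rw [mem_blk] at hp; rw [hp]; exact hi) hFi), ih hFA]

/-! ### `G` intertwines the two noise operators (KLM Lemma 4.3 (1)) -/

/-- `id ⊗ T_{σ,C}` commutes with `E_B ⊗ id`. [cite: KellerLifshitzMarcus2023, Lemma 4.3] -/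
theorem condAvg_noiseOnB_comm [NeZero m] (σ : ℝ) (C : Finset (Fin N × Fin m)) (B : Finset (Fin N))
    (G : MixFun N m) :
    opX (condAvg B) (fun x => noiseOn (α := fun _ : Fin N × Fin m => Bool) σ C (G x)) =
      fun x => noiseOn (α := fun _ : Fin N × Fin m => Bool) σ C (opX (condAvg B) G x) := by
  funext x
  show (fun z => condAvg B (fun x' => noiseOn (α := fun _ : Fin N × Fin m => Bool) σ C (G x') z) x) = _
  unfold opX condAvg
  rw [show (fun z => (∑ y, G (B.piecewise y x) z) / cardX (fun _ : Fin N => Fin m)) =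
      fun z => (cardX (fun _ : Fin N => Fin m))⁻¹ * ∑ y ∈ univ, (fun y z => G (B.piecewise y x) z) y z by
    funext z; rw [div_eq_inv_mul],
    noiseOn_smul, noiseOn_finset_sum]
  funext z
  rw [div_eq_inv_mul]

/-- `id ⊗ T_{σ,C}` commutes with `L_S ⊗ id`. [cite: KellerLifshitzMarcus2023, Lemma 4.3] -/
theorem lap_noiseOnB_comm [NeZero m] (σ : ℝ) (C : Finset (Fin N × Fin m)) (S : Finset (Fin N))
    (G : MixFun N m) :
    opX (lap S) (fun x => noiseOn (α := fun _ : Fin N × Fin m => Bool) σ C (G x)) =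
      fun x => noiseOn (α := fun _ : Fin N × Fin m => Bool) σ C (opX (lap S) G x) := by
  funext x z
  show lap S (fun x' => noiseOn (α := fun _ : Fin N × Fin m => Bool) σ C (G x') z) x =
    noiseOn (α := fun _ : Fin N × Fin m => Bool) σ C (fun z' => lap S (fun x' => G x' z') x) z
  unfold lap
  have hR : (fun z' => ∑ R ∈ S.powerset, (-1 : ℝ) ^ R.card * condAvg R (fun x' => G x' z') x) =
      fun z' => ∑ R ∈ S.powerset, (fun R z' => (-1 : ℝ) ^ R.card * condAvg R (fun x' => G x' z') x) R z' := rfl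
  rw [hR, noiseOn_finset_sum]
  show _ = ∑ R ∈ S.powerset, noiseOn (α := fun _ : Fin N × Fin m => Bool) σ C
    (fun z' => (-1 : ℝ) ^ R.card * condAvg R (fun x' => G x' z') x) z
  refine Finset.sum_congr rfl fun R _ => ?_
  rw [noiseOn_smul]
  show _ = (-1 : ℝ) ^ R.card * noiseOn (α := fun _ : Fin N × Fin m => Bool) σ C
    (fun z' => condAvg R (fun x' => G x' z') x) z
  congr 1
  have := condAvg_noiseOnB_comm σ C R G
  exact congrFun (congrFun this x) z

/-- `G_i` commutes with `id ⊗ T_{σ,C}` when `C` contains no sign of block `i`.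
[cite: KellerLifshitzMarcus2023, Lemma 4.3] -/
theorem enc1_noiseOnB_comm [NeZero m] (σ : ℝ) {C : Finset (Fin N × Fin m)} {i : Fin N}
    (hC : ∀ p ∈ C, p.1 ≠ i) (G : MixFun N m) :
    enc1 i (fun x => noiseOn (α := fun _ : Fin N × Fin m => Bool) σ C (G x)) =
      fun x => noiseOn (α := fun _ : Fin N × Fin m => Bool) σ C (enc1 i G x) := by
  funext x
  have hw : ∀ a, DependsOff (α := fun _ : Fin N × Fin m => Bool) C (fun z => encW z i a (x i)) := by
    intro a z z' h
    show encW z i a (x i) = encW z' i a (x i)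
    rw [encW_congr (fun a' => h (i, a') (fun hmem => hC _ hmem rfl))]
  show (fun z => kone i (encW z) (fun x' => noiseOn (α := fun _ : Fin N × Fin m => Bool) σ C (G x') z) x) =
    noiseOn (α := fun _ : Fin N × Fin m => Bool) σ C (fun z => kone i (encW z) (fun x' => G x' z) x)
  unfold kone
  rw [show (fun z => (∑ a, encW z i a (x i) * G (Function.update x i a) z) / (Fintype.card (Fin m) : ℝ)) =
      fun z => (Fintype.card (Fin m) : ℝ)⁻¹ * ∑ a ∈ univ,
        (fun a z => encW z i a (x i) * G (Function.update x i a) z) a z by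
    funext z; rw [div_eq_inv_mul],
    noiseOn_smul, noiseOn_finset_sum]
  funext z
  rw [div_eq_inv_mul]
  congr 1
  refine Finset.sum_congr rfl fun a _ => ?_
  have := noiseOn_mul_of_dependsOff σ (hw a) (G (Function.update x i a))
  exact (congrFun this z).symm

/-- **`G_i T^{Ω}_{σ,i} = T^{cube}_{σ, blk i} G_i`** on functions not reading the signs of block `i`
(KLM Lemma 4.3(1) in one coordinate: `T_ρ(α_0 + α_1 z) = α_0 + ρ α_1 z` on both sides).
[cite: KellerLifshitzMarcus2023, Lemma 4.3 (1) ("`T_ρ G_S = G_S T_ρ` … reduces to the case `n = 1`")] -/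
theorem enc1_noiseOn [NeZero m] (σ : ℝ) (i : Fin N) {G : MixFun N m}
    (hG : ∀ x, DependsOff (α := fun _ : Fin N × Fin m => Bool) (blk i) (G x)) :
    enc1 i (opX (noiseOn σ {i}) G) =
      fun x => noiseOn (α := fun _ : Fin N × Fin m => Bool) σ (blk i) (enc1 i G x) := by
  -- left side: `E_i + σ Λ_i`
  have hE : opX (condAvg {i}) (opX (noiseOn σ {i}) G) = opX (condAvg {i}) G := by
    rw [opX_opX]
    exact opX_congr_of (fun g => by
      show condAvg {i} (noiseOn σ {i} g) = condAvg {i} g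
      rw [condAvg_noiseOn_comm, noiseOn_of_dependsOff σ (dependsOff_condAvg {i} g)]) G
  have hL : ∀ x z, encLin i (opX (noiseOn σ {i}) G) x z = σ * encLin i G x z := by
    intro x z
    unfold encLin opX
    have h1 : lap {i} (fun x' => noiseOn σ {i} (fun x'' => G x'' z) x') =
        fun x' => σ * lap {i} (fun x'' => G x'' z) x' := by
      show lap {i} (noiseOn σ {i} (fun x'' => G x'' z)) = _
      rw [lap_noiseOn_comm, noiseOn_singleton]
      funext x'
      rw [condAvg_lap_eq_zero (Finset.mem_singleton_self i) (Finset.mem_singleton_self i), lap_lap,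
        Finset.union_idempotent]
      ring
    rw [h1, Finset.mul_sum, Finset.mul_sum, Finset.mul_sum]
    exact Finset.sum_congr rfl fun a _ => by simp only; ring
  have lhs : enc1 i (opX (noiseOn σ {i}) G) = fun x z => opX (condAvg {i}) G x z + σ * encLin i G x z := by
    rw [enc1_eq, hE]
    funext x z
    rw [hL]
  -- right side
  have hEd : ∀ x, DependsOff (α := fun _ : Fin N × Fin m => Bool) (blk i) (opX (condAvg {i}) G x) :=
    dependsOff_opX_cube hG _
  have hcd : ∀ x a, DependsOff (α := fun _ : Fin N × Fin m => Bool) (blk i)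
      (fun z => (Real.sqrt m)⁻¹ * lap {i} (fun x' => G x' z) (Function.update x i a)) := by
    intro x a z z' h
    have := dependsOff_opX_cube hG (lap {i}) (Function.update x i a) z z' h
    show (Real.sqrt m)⁻¹ * _ = (Real.sqrt m)⁻¹ * _
    exact congrArg _ this
  have rhs : ∀ x, noiseOn (α := fun _ : Fin N × Fin m => Bool) σ (blk i) (enc1 i G x) =
      fun z => opX (condAvg {i}) G x z + σ * encLin i G x z := by
    intro x
    rw [enc1_eq]
    show noiseOn (α := fun _ : Fin N × Fin m => Bool) σ (blk i)
      (fun z => opX (condAvg {i}) G x z + encLin i G x z) = _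
    rw [noiseOn_add, noiseOn_of_dependsOff σ (hEd x)]
    funext z
    congr 1
    unfold encLin
    rw [show (fun z => (Real.sqrt m)⁻¹ * ∑ a, lap {i} (fun x' => G x' z) (Function.update x i a) * sgn (z (i, a))) =
        fun z => ∑ a ∈ univ, (fun a z => ((Real.sqrt m)⁻¹ * lap {i} (fun x' => G x' z) (Function.update x i a)) *
          sgn (z (i, a))) a z by
      funext z; rw [Finset.mul_sum]; exact Finset.sum_congr rfl fun a _ => by ring]
    rw [noiseOn_finset_sum]
    show ∑ a ∈ univ, noiseOn (α := fun _ : Fin N × Fin m => Bool) σ (blk i)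
        (fun z => ((Real.sqrt m)⁻¹ * lap {i} (fun x' => G x' z) (Function.update x i a)) * sgn (z (i, a))) z = _
    rw [Finset.mul_sum, Finset.mul_sum]
    refine Finset.sum_congr rfl fun a _ => ?_
    rw [noiseOn_mul_of_dependsOff σ (hcd x a), noiseOn_sgn σ (show ((i, a) : Fin N × Fin m) ∈ blk i by simp)]
    ring
  rw [lhs]
  funext x
  rw [rhs]

/-- **`G_A T^{Ω}_{σ,A} = T^{cube}_{σ, bits A} G_A`** on sign-free-on-`A` functions (KLM Lemma 4.3(1)).
[cite: KellerLifshitzMarcus2023, Lemma 4.3 (1)] -/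
theorem encA_noiseOn [NeZero m] (σ : ℝ) {A : Finset (Fin N)} {F : MixFun N m}
    (hF : ∀ x, DependsOff (α := fun _ : Fin N × Fin m => Bool) (bits A) (F x)) :
    encA A (opX (noiseOn σ A) F) =
      fun x => noiseOn (α := fun _ : Fin N × Fin m => Bool) σ (bits A) (encA A F x) := by
  induction A using Finset.induction_on generalizing F with
  | empty =>
    rw [encA_empty, encA_empty, opX_congr_of (fun g => noiseOn_empty σ g)]
    funext x
    rw [bits_empty, noiseOn_empty]
    rfl
  | insert i A hi ih =>
    have hFi : ∀ x, DependsOff (α := fun _ : Fin N × Fin m => Bool) (blk i) (F x) := fun x =>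
      (hF x).mono (by rw [bits_insert]; exact Finset.subset_union_left)
    have hFA : ∀ x, DependsOff (α := fun _ : Fin N × Fin m => Bool) (bits A) (F x) := fun x =>
      (hF x).mono (by rw [bits_insert]; exact Finset.subset_union_right)
    have hdisj : Disjoint ({i} : Finset (Fin N)) A := Finset.disjoint_singleton_left.2 hi
    have hGA : ∀ x, DependsOff (α := fun _ : Fin N × Fin m => Bool) (blk i) (encA A F x) :=
      dependsOff_encA_cube (fun p hp => by rw [mem_blk] at hp; rw [hp]; exact hi) hFi
    calc encA (insert i A) (opX (noiseOn σ (insert i A)) F)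
        = enc1 i (encA A (opX (noiseOn σ {i}) (opX (noiseOn σ A) F))) := by
          rw [encA_insert hi, opX_opX]
          congr 2
          exact opX_congr_of (fun g => by
            show noiseOn σ (insert i A) g = noiseOn σ {i} (noiseOn σ A g)
            rw [noiseOn_noiseOn_of_disjoint σ hdisj, Finset.insert_eq]) F
      _ = enc1 i (opX (noiseOn σ {i}) (encA A (opX (noiseOn σ A) F))) := by
          rw [encA_noiseOn_comm σ hdisj]
      _ = enc1 i (opX (noiseOn σ {i}) (fun x => noiseOn (α := fun _ : Fin N × Fin m => Bool) σ (bits A)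
            (encA A F x))) := by rw [ih hFA]
      _ = enc1 i (fun x => noiseOn (α := fun _ : Fin N × Fin m => Bool) σ (bits A)
            (opX (noiseOn σ {i}) (encA A F) x)) := by
          congr 1
          rw [opX_congr_of (fun g => noiseOn_singleton σ i g), opX_congr_of (fun g => noiseOn_singleton σ i g)]
          funext x z
          show condAvg {i} (fun x' => noiseOn (α := fun _ : Fin N × Fin m => Bool) σ (bits A) (encA A F x') z) x +
              σ * lap {i} (fun x' => noiseOn (α := fun _ : Fin N × Fin m => Bool) σ (bits A) (encA A F x') z) x = _
          have h1 := congrFun (congrFun (condAvg_noiseOnB_comm σ (bits A) {i} (encA A F)) x) z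
          have h2 := congrFun (congrFun (lap_noiseOnB_comm σ (bits A) {i} (encA A F)) x) z
          simp only [opX] at h1 h2
          rw [h1, h2]
          show _ = noiseOn (α := fun _ : Fin N × Fin m => Bool) σ (bits A)
            (fun z => condAvg {i} (fun x' => encA A F x' z) x + σ * lap {i} (fun x' => encA A F x' z) x) z
          rw [noiseOn_add, noiseOn_smul]
          rfl
      _ = fun x => noiseOn (α := fun _ : Fin N × Fin m => Bool) σ (bits A)
            (enc1 i (opX (noiseOn σ {i}) (encA A F)) x) := by
          rw [enc1_noiseOnB_comm σ (fun p hp => by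
            rw [mem_bits] at hp; exact fun h => hi (h ▸ hp))]
      _ = fun x => noiseOn (α := fun _ : Fin N × Fin m => Bool) σ (bits A)
            (noiseOn (α := fun _ : Fin N × Fin m => Bool) σ (blk i) (enc1 i (encA A F) x)) := by
          rw [enc1_noiseOn σ i hGA]
      _ = fun x => noiseOn (α := fun _ : Fin N × Fin m => Bool) σ (bits (insert i A)) (encA (insert i A) F x) := by
          funext x
          rw [noiseOn_noiseOn_of_disjoint σ (disjoint_blk_bits hi).symm, bits_insert, Finset.union_comm,
            encA_insert hi]

/-- **`G_A F` is sign-side `T`-ready**: for `g` depending only on the coordinates `A`, the encoded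
`G_A g` does not depend on `x` at all. [cite: KellerLifshitzMarcus2023, Thm. 4.1 (proof: "`G_{S^c} D_{S,x} f` is a function on the Gaussian space `(ℝ^{k-1})^{S^c}`")] -/
theorem encA_liftX_const [NeZero m] {A : Finset (Fin N)} {g : (Fin N → Fin m) → ℝ}
    (hg : DependsOff (α := fun _ : Fin N => Fin m) Aᶜ g) (x x' : Fin N → Fin m) (z : Cube N m) :
    encA A (liftX g) x z = encA A (liftX g) x' z := by
  -- average `x` into `x'` coordinate by coordinate: first the `A`-part, then the rest
  have h1 : encA A (liftX g) x z = encA A (liftX g) (A.piecewise x' x) z :=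
    dependsOff_encA_X A (liftX g) z x _ (fun j hj => by simp [Finset.piecewise, hj])
  have h2 : encA A (liftX g) (A.piecewise x' x) z = encA A (liftX g) x' z :=
    dependsOff_encA_X_of (B := Aᶜ) (by rw [Finset.disjoint_left]; intro j hj; simpa using hj)
      (fun _ => hg) z _ _ (fun j hj => by
        have : j ∈ A := by simpa using hj
        simp [Finset.piecewise, this])
  rw [h1, h2]

end Mixed


end Literature.Combinatorics.Additive.ProductSpace
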